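import Summits.HodgeConjecture.HodgeConjecture.Theorems.HeckePrymWeilAimedDescendingIsotropicGlueAll
import Summits.HodgeConjecture.HodgeConjecture.Theorems.HeckePrymWeilAimedDescendingProductFrame
import Summits.HodgeConjecture.HodgeConjecture.Theorems.HeckePrymWeilAimedDescendingRationalModel
import Summits.HodgeConjecture.HodgeConjecture.Theorems.HeckePrymWeilWeilSixfoldsSqrtMinus7CmSurfaceModel
import Summits.HodgeConjecture.HodgeConjecture.Theorems.HeckePrymWeilWeilSixfoldsSqrtMinus7CmDescentPair
import Literature.AlgebraicGeometry.Motives.AbelianVarietyProductDimProofs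
import Literature.AlgebraicGeometry.HodgeTheory.ComplexConjugation
import HarnessLib

/-!
# Crux `WeilSixfoldsSqrtMinus7` (stmt-HodgeConjecture-1260), line `hyperbolic-eightfold-descent` — Stub 7 (the AIMED PARTNER at `d = 7`) ASSEMBLED from its sub-goals

Route `HeckePrymWeil`. The line reduces the crux (Hodge–Weil classes on every `ℚ(√-7)`-Weil abelian
sixfold, all discriminants) to the split EIGHTFOLD crux `HyperbolicEightfoldsSqrtMinus7` (item 14642)
plus the AIMED PARTNER at `d = 7` (the registered stub S7 of the line's skeleton; composition landed in
`Theorems/HeckePrymWeilWeilSixfoldsSqrtMinus7OfAimedPartner`): for every Weil-type `(A, φ)` of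
dimension `2n` with `φ ≫ φ = -7` a Weil SURFACE partner `(B, ψ)` with a descent pair and a projective
embedding of `A × B` for whose `K`-symmetrised hyperplane class `(A × B, φ × ψ)` is of HYPERBOLIC Weil
type in half-dimension `n + 1` (B. van Geemen, LNM 1594 (1994), Lemma 5.2 (2)–(3), 5.3, 5.4 (5.4.1);
E. Markman, arXiv:2509.23403 §11.5 Step 2, printed for `6 → 4`; C. Schoen, Compositio 114 (1998) §10).

This file PROVES S7 from its registered sub-goals, on the tree's real carriers and sorry-free:

* `aimedPartnerSeven_of_parts : G1 → G3 → G4′ → S7`, where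
  - G1 (`stub_cmCurveSeven`, hypothesis): a complex elliptic curve `E` with `ι ≫ ι = -7` (the CM curve
    `j = -3375`; under construction by the sibling line of crux 1261);
  - G3 (`stub_weilSignature`, hypothesis): the rational degree-one model of a Weil-type `(A, φ, h_A)`
    WITH ITS SIGNATURE `(n, n)` (Hodge–Riemann in degree one; proved by this line as
    `stub_weilSignature_of` modulo HR₁ below, which the tree has meanwhile PROVED:
    `HodgeTheory.hodgeRiemann_degreeOne_of_isOfHodgeType`, registered stub `stub_hodgeRiemannOne`);
  - G4′ (`stub_hyperplaneCalculusSym`, hypothesis): the compatible hyperplane classes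
    `g_N = c₁(𝒪_{ℙᴺ}(1))` on `complexBetti` with Segre additivity, Veronese weights, spanning of
    `H²(ℙᴺ(ℂ); ℚ)` and the `φ`-twisted re-embedding (its five-clause core `stub_hyperplaneCalculus` is
    landed, p117206);
  and the LANDED sub-goals G2a `stub_cmSurfaceModel` (the CM surface `(E × E, (ι, -ι))` with its
  weighted rational degree-one model, p109969) and G2b `stub_cmDescentPair` (its descent pair, p106235)
  are used as theorems. PROOF (docstring of the theorem): rational model + signature of `(A, φ, h_A)`
  (G3), the CM surface model (G1, G2a), the arithmetic `Theorems.exists_isotropic_blockVectors'`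
  (item 14643 file XII) returning the weights `(m₁, m₂)`, the weighted Segre embedding (G4′) whose
  `K`-symmetrised hyperplane class is `fst^* h_A + snd^*(14·y)`, and the product frame
  `Theorems.isHyperbolicWeilType_prod_of_rationalModels` (file VI), whose block Gram matrix is
  literally the matrix of file XII for these data.
* `hodgeRiemannOne_symmetrised : HR₁ → G4′ → HR₁(h_A)` — the Hodge–Riemann input of G3 for the
  `K`-SYMMETRISED class `h_A = 7·e^*a + φ^*e^*a` follows from Hodge–Riemann in degree one for PLAIN
  hyperplane classes (HR₁ = the registered stub `stub_hodgeRiemannOne`, verbatim as hypothesis; it is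
  the tree's theorem `HodgeTheory.hodgeRiemann_degreeOne_of_isOfHodgeType` re-indexed): `a = t·g`
  (spanning), `7·e^*g + φ^*e^*g = e'^* g` for the `φ`-twisted re-embedding `e'` (G4′ (7)), so
  `h_A = e'^*(t·g)`.

What remains for S7 after this file: the landings of G1 (now a corollary of the sibling line's
`exists_cmCurveModel`), of HR₁ (a corollary of `hodgeRiemann_degreeOne_of_isOfHodgeType`), of G3
modulo HR₁ (`stub_weilSignature_of`) and of G4′ — all in flight; no named fact remains.
-/

noncomputable section

-- every declaration of this problem lives in `Summit.HodgeConjecture.HodgeConjecture.…`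
set_option linter.dupNamespace false

open CategoryTheory
open Literature.AlgebraicGeometry Literature.AlgebraicGeometry.Motives
  Literature.AlgebraicGeometry.HodgeTheory Literature.AlgebraicTopology.SingularHomology
  Literature.Geometry.Kaehler

namespace Summit.HodgeConjecture.HodgeConjecture.Theorems.WeilSixfoldsSqrtMinus7.HyperbolicEightfoldDescent

/-- `J = !![0,1;-1,0]` is alternating for the dot-product pairing `(x, y) ↦ y ⬝ᵥ J x`. [folklore] -/
theorem J_dotProduct_alternating (x y : Fin 2 → ℚ) :
    y ⬝ᵥ (!![(0 : ℚ), 1; -1, 0]).mulVec x = -(x ⬝ᵥ (!![(0 : ℚ), 1; -1, 0]).mulVec y) := by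
  simp [Matrix.mulVec, dotProduct, Fin.sum_univ_two]
  ring

/-- The coefficient vector `![1, 0] ∈ ℚ²` is non-zero. [folklore] -/
theorem vecOneZero_ne_zero : (![1, 0] : Fin 2 → ℚ) ≠ 0 := by
  intro h
  have := congrFun h 0
  simp at this

/-- **Hodge–Riemann in degree one for the `K`-symmetrised hyperplane class from the named fact for
plain hyperplane classes and the extended hyperplane calculus G4′.** For `(A, φ)` of dimension `2n`,
`φ ≫ φ = -7`, an embedding `e` and a rational `a ≠ 0`: `a = t·g_{e.n}`, `t ∈ ℚ^×` (G4′ (6)); the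
`φ`-twisted re-embedding `e'` has `e'^* g = 7·e^*g + φ^*e^*g` (G4′ (7)); hence
`h_A = 7·e^*a + φ^*e^*a = e'^*(t·g)` with `t·g` rational and non-zero (`e'.n ≥ 1`, G4′ (2)–(3)), and the
statement HR₁ for `(e', t·g)` is the claim. This is the input `hHR` of the line's `stub_weilSignature_of`.
[cite: VoisinHodgeI2002, Thm. 6.32] [cite: vanGeemen1994HodgeAV, Lemma 5.2 (1) and proof of (4)–(5)] -/
theorem hodgeRiemannOne_symmetrised :
    (∀ (d : ℕ) (X : SchemeOver ℂ), IsSmoothProjective d X → 1 ≤ d → ∀ (e : ProjectiveEmbedding X) (a : complexBetti (projectiveSpace e.n ℂ) 2), IsRationalClass a → a ≠ 0 → ∃ ω₀ : complexBetti X (2 + 2 * (d - 1)), ω₀ ≠ 0 ∧ ∀ x : complexBetti X 1, IsOfHodgeType d X 1 1 0 x → x ≠ 0 → ∃ r : ℝ, 0 < r ∧ Complex.I • polarizationPairingOne X (complexBetti.map e.ι 2 a) (d - 1) x (conjClass (ComplexPoints X) 1 x) = ((r : ℝ) : ℂ) • ω₀) →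
    (∃ g : ∀ N : ℕ, complexBetti (projectiveSpace N ℂ) 2,
      (∀ N, IsRationalClass (g N)) ∧ (∀ N, 1 ≤ N → g N ≠ 0) ∧
      (∀ (X : AbelianVariety ℂ) (e : ProjectiveEmbedding X.X), 1 ≤ X.dim → 1 ≤ e.n) ∧
      (∀ (X Y : AbelianVariety ℂ) (eX : ProjectiveEmbedding X.X) (eY : ProjectiveEmbedding Y.X),
        ∃ e : ProjectiveEmbedding (X.prod Y).X,
          complexBetti.map e.ι 2 (g e.n) =
            complexBetti.map (AbelianVariety.fst X Y).hom.hom.hom 2 (complexBetti.map eX.ι 2 (g eX.n)) +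
            complexBetti.map (AbelianVariety.snd X Y).hom.hom.hom 2 (complexBetti.map eY.ι 2 (g eY.n))) ∧
      (∀ (X : AbelianVariety ℂ) (eX : ProjectiveEmbedding X.X) (m : ℕ), 0 < m →
        ∃ e : ProjectiveEmbedding X.X,
          complexBetti.map e.ι 2 (g e.n) = (m : ℂ) • complexBetti.map eX.ι 2 (g eX.n)) ∧
      (∀ (N : ℕ) (a : complexBetti (projectiveSpace N ℂ) 2), IsRationalClass a →
        ∃ t : ℚ, a = ((t : ℚ) : ℂ) • g N) ∧
      (∀ (X : AbelianVariety ℂ) (φ : X ⟶ X) (eX : ProjectiveEmbedding X.X) (m : ℕ), 0 < m →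
        ∃ e : ProjectiveEmbedding X.X,
          complexBetti.map e.ι 2 (g e.n) =
            (m : ℂ) • complexBetti.map eX.ι 2 (g eX.n) +
              complexBetti.map φ.hom.hom.hom 2 (complexBetti.map eX.ι 2 (g eX.n)))) →
    ∀ (n : ℕ) (A : AbelianVariety ℂ) (φ : A ⟶ A), 1 ≤ n → A.dim = 2 * n → φ ≫ φ = -((7 : ℤ) • 𝟙 A) →
      ∀ (e : ProjectiveEmbedding A.X) (a : complexBetti (projectiveSpace e.n ℂ) 2),
        IsRationalClass a → a ≠ 0 →
        ∃ ω₀ : complexBetti A.X (2 + 2 * (2 * n - 1)), ω₀ ≠ 0 ∧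
          ∀ x : complexBetti A.X 1, IsOfHodgeType (2 * n) A.X 1 1 0 x → x ≠ 0 →
            ∃ r : ℝ, 0 < r ∧
              Complex.I • polarizationPairingOne A.X
                ((7 : ℂ) • complexBetti.map e.ι 2 a + complexBetti.map φ.hom.hom.hom 2 (complexBetti.map e.ι 2 a))
                (2 * n - 1) x (conjClass (ComplexPoints A.X) 1 x) = (r : ℂ) • ω₀ := by
  intro hHR hG n A φ hn hA hφ e a ha ha0
  obtain ⟨g, hg_rat, hg_ne, hg_dim, -, -, hg_span, hg_sym⟩ := hG
  have hX : IsSmoothProjective (2 * n) A.X := by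
    have h := AbelianVariety.isSmoothProjective_holds (A := A)
    rw [AbelianVariety.isSmoothProjective, hA] at h
    exact h
  -- `a = t • g`
  obtain ⟨t, rfl⟩ := hg_span e.n a ha
  have ht : t ≠ 0 := by
    rintro rfl
    exact ha0 (by simp)
  -- the twisted re-embedding `e'` with `e'^* g = 7 • e^* g + φ^* e^* g`
  obtain ⟨e', he'⟩ := hg_sym A φ e 7 (by norm_num)
  have hn' : 1 ≤ e'.n := hg_dim A e' (by omega)
  have ha' : IsRationalClass (((t : ℚ) : ℂ) • g e'.n) := (hg_rat e'.n).smul t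
  have ha'0 : ((t : ℚ) : ℂ) • g e'.n ≠ 0 := by
    intro h0
    rcases smul_eq_zero.1 h0 with h1 | h1
    · exact ht (by exact_mod_cast h1)
    · exact hg_ne e'.n hn' h1
  obtain ⟨ω₀, hω₀, hpos⟩ := hHR (2 * n) A.X hX (by omega) e' _ ha' ha'0
  refine ⟨ω₀, hω₀, fun x hx hx0 => ?_⟩
  obtain ⟨r, hr, hrx⟩ := hpos x hx hx0
  refine ⟨r, hr, ?_⟩
  -- identify the two classes
  have hcl : (7 : ℂ) • complexBetti.map e.ι 2 (((t : ℚ) : ℂ) • g e.n) +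
      complexBetti.map φ.hom.hom.hom 2 (complexBetti.map e.ι 2 (((t : ℚ) : ℂ) • g e.n)) =
      complexBetti.map e'.ι 2 (((t : ℚ) : ℂ) • g e'.n) := by
    rw [map_smul, map_smul, map_smul, he', smul_add, smul_comm]
    push_cast
    rw [smul_comm ((t : ℚ) : ℂ) (7 : ℂ)]
  rw [hcl]
  exact hrx


/-- **Stub 7 of line `hyperbolic-eightfold-descent` — the AIMED PARTNER at `d = 7` — from its
sub-goals G1 (CM curve), G3 (Weil signature) and G4′ (hyperplane calculus), using the landed G2a
(`stub_cmSurfaceModel`) and G2b (`stub_cmDescentPair`).** See the module docstring for the proof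
(van Geemen LNM 1594, 5.2–5.4; Markman arXiv:2509.23403 §11.5 Step 2; Schoen 1998 §10), which runs
through `Theorems.exists_isotropic_blockVectors'` (file XII) and
`Theorems.isHyperbolicWeilType_prod_of_rationalModels` (file VI) of item 14643.
[cite: vanGeemen1994HodgeAV, Lemma 5.2 (2)–(3), 5.3 and 5.4 (5.4.1)] [cite: Markman2025SurveySecant, §11.5 Step 2]
[cite: Schoen1998HodgeWeilAddendum, §10] -/
theorem aimedPartnerSeven_of_parts :
    (∃ (E : AbelianVariety ℂ) (ι : E ⟶ E), E.dim = 1 ∧ ι ≫ ι = -((7 : ℤ) • 𝟙 E)) →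
    (∀ (n : ℕ) (A : AbelianVariety ℂ) (φ : A ⟶ A), 1 ≤ n → A.dim = 2 * n → φ ≫ φ = -((7 : ℤ) • 𝟙 A) →
      (∃ c : complexBetti A.X (2 * n), c ≠ 0 ∧ IsRationalClass c ∧
        IsOfHodgeType (2 * n) A.X (2 * n) n n c ∧
        c ∈ Module.End.eigenspace (complexBetti.map (𝟙 A + φ).hom.hom.hom (2 * n)).hom
              ((1 + Complex.I * (Real.sqrt (7 : ℝ) : ℂ)) ^ (2 * n)) ⊔
            Module.End.eigenspace (complexBetti.map (𝟙 A + φ).hom.hom.hom (2 * n)).hom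
              ((1 - Complex.I * (Real.sqrt (7 : ℝ) : ℂ)) ^ (2 * n))) →
      ∀ (e : ProjectiveEmbedding A.X) (a : complexBetti (projectiveSpace e.n ℂ) 2),
        IsRationalClass a → a ≠ 0 →
        ∃ (u : Fin (4 * n) → complexBetti A.X 1) (M G : Matrix (Fin (4 * n)) (Fin (4 * n)) ℚ)
          (ω : complexBetti A.X (2 + 2 * (2 * n - 1))) (d₀ : ℚ),
          (∀ i, IsRationalClass (u i)) ∧ LinearIndependent ℂ u ∧ Submodule.span ℂ (Set.range u) = ⊤ ∧
          (∀ i, complexBetti.map φ.hom.hom.hom 1 (u i) = ∑ k, ((M k i : ℚ) : ℂ) • u k) ∧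
          IsRationalClass ω ∧ ω ≠ 0 ∧
          (∀ i k, polarizationPairingOne A.X
              ((7 : ℂ) • complexBetti.map e.ι 2 a + complexBetti.map φ.hom.hom.hom 2 (complexBetti.map e.ι 2 a))
              (2 * n - 1) (u i) (u k) = ((G i k : ℚ) : ℂ) • ω) ∧
          lefschetzPow
              ((7 : ℂ) • complexBetti.map e.ι 2 a + complexBetti.map φ.hom.hom.hom 2 (complexBetti.map e.ι 2 a))
              (2 * n - 1) 2
              ((7 : ℂ) • complexBetti.map e.ι 2 a + complexBetti.map φ.hom.hom.hom 2 (complexBetti.map e.ι 2 a)) =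
            ((d₀ : ℚ) : ℂ) • ω ∧
          (∀ v, M.mulVec (M.mulVec v) = -((7 : ℚ) • v)) ∧
          (∀ x y : Fin (4 * n) → ℚ, y ⬝ᵥ G.mulVec x = -(x ⬝ᵥ G.mulVec y)) ∧
          (∀ x y : Fin (4 * n) → ℚ, M.mulVec x ⬝ᵥ G.mulVec (M.mulVec y) = 7 * (x ⬝ᵥ G.mulVec y)) ∧
          ∃ P N : Submodule ℚ (Fin (4 * n) → ℚ),
            (∀ v ∈ P, M.mulVec v ∈ P) ∧ (∀ v ∈ N, M.mulVec v ∈ N) ∧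
            Module.finrank ℚ P = 2 * n ∧ Module.finrank ℚ N = 2 * n ∧ P ⊓ N = ⊥ ∧
            (∀ x ∈ P, x ≠ 0 → 0 < x ⬝ᵥ G.mulVec (M.mulVec x)) ∧
            (∀ x ∈ N, x ≠ 0 → x ⬝ᵥ G.mulVec (M.mulVec x) < 0)) →
    (∃ g : ∀ N : ℕ, complexBetti (projectiveSpace N ℂ) 2,
      (∀ N, IsRationalClass (g N)) ∧ (∀ N, 1 ≤ N → g N ≠ 0) ∧
      (∀ (X : AbelianVariety ℂ) (e : ProjectiveEmbedding X.X), 1 ≤ X.dim → 1 ≤ e.n) ∧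
      (∀ (X Y : AbelianVariety ℂ) (eX : ProjectiveEmbedding X.X) (eY : ProjectiveEmbedding Y.X),
        ∃ e : ProjectiveEmbedding (X.prod Y).X,
          complexBetti.map e.ι 2 (g e.n) =
            complexBetti.map (AbelianVariety.fst X Y).hom.hom.hom 2 (complexBetti.map eX.ι 2 (g eX.n)) +
            complexBetti.map (AbelianVariety.snd X Y).hom.hom.hom 2 (complexBetti.map eY.ι 2 (g eY.n))) ∧
      (∀ (X : AbelianVariety ℂ) (eX : ProjectiveEmbedding X.X) (m : ℕ), 0 < m →
        ∃ e : ProjectiveEmbedding X.X,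
          complexBetti.map e.ι 2 (g e.n) = (m : ℂ) • complexBetti.map eX.ι 2 (g eX.n)) ∧
      (∀ (N : ℕ) (a : complexBetti (projectiveSpace N ℂ) 2), IsRationalClass a →
        ∃ t : ℚ, a = ((t : ℚ) : ℂ) • g N) ∧
      (∀ (X : AbelianVariety ℂ) (φ : X ⟶ X) (eX : ProjectiveEmbedding X.X) (m : ℕ), 0 < m →
        ∃ e : ProjectiveEmbedding X.X,
          complexBetti.map e.ι 2 (g e.n) =
            (m : ℂ) • complexBetti.map eX.ι 2 (g eX.n) +
              complexBetti.map φ.hom.hom.hom 2 (complexBetti.map eX.ι 2 (g eX.n)))) →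
    ∀ (n : ℕ) (A : AbelianVariety ℂ) (φ : A ⟶ A), 1 ≤ n → A.dim = 2 * n → φ ≫ φ = -((7 : ℤ) • 𝟙 A) →
      (∃ c : complexBetti A.X (2 * n), c ≠ 0 ∧ IsRationalClass c ∧
        IsOfHodgeType (2 * n) A.X (2 * n) n n c ∧
        c ∈ Module.End.eigenspace (complexBetti.map (𝟙 A + φ).hom.hom.hom (2 * n)).hom
              ((1 + Complex.I * (Real.sqrt (7 : ℝ) : ℂ)) ^ (2 * n)) ⊔
            Module.End.eigenspace (complexBetti.map (𝟙 A + φ).hom.hom.hom (2 * n)).hom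
              ((1 - Complex.I * (Real.sqrt (7 : ℝ) : ℂ)) ^ (2 * n))) →
      ∃ (B : AbelianVariety ℂ) (ψ : B ⟶ B), B.dim = 2 ∧ ψ ≫ ψ = -((7 : ℤ) • 𝟙 B) ∧
        (∃ bp bm η : complexBetti B.X 2,
          bp ∈ Module.End.eigenspace (complexBetti.map (𝟙 B + ψ).hom.hom.hom 2).hom
                ((1 + Complex.I * (Real.sqrt (7 : ℝ) : ℂ)) ^ 2) ∧
          bm ∈ Module.End.eigenspace (complexBetti.map (𝟙 B + ψ).hom.hom.hom 2).hom
                ((1 - Complex.I * (Real.sqrt (7 : ℝ) : ℂ)) ^ 2) ∧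
          IsRationalClass (bp + bm) ∧ IsOfHodgeType 2 B.X 2 1 1 (bp + bm) ∧
          η ∈ algebraicClasses B.X 1 ∧
          cupProduct (show 2 + 2 = 4 from rfl) bp η ≠ 0 ∧
          cupProduct (show 2 + 2 = 4 from rfl) bm η ≠ 0) ∧
        ∃ (e : ProjectiveEmbedding (A.prod B).X) (a : complexBetti (projectiveSpace e.n ℂ) 2),
          IsRationalClass a ∧ a ≠ 0 ∧
          IsHyperbolicWeilType (A.prod B)
            (AbelianVariety.prodLift (AbelianVariety.fst A B ≫ φ) (AbelianVariety.snd A B ≫ ψ))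
            (n + 1)
            ((7 : ℂ) • complexBetti.map e.ι 2 a +
              complexBetti.map (AbelianVariety.prodLift (AbelianVariety.fst A B ≫ φ)
                (AbelianVariety.snd A B ≫ ψ)).hom.hom.hom 2 (complexBetti.map e.ι 2 a)) := by
  intro h₁ h₄ h₅ n A φ hn hA hφ hwit
  classical
  -- G1: the CM curve
  obtain ⟨E, ι, hE, hι⟩ := h₁
  -- G2a: the CM surface model
  obtain ⟨α, β, ME, w, ωB, hα, hβ, hind, hspan, hωne, hME2, hMEcol, hψψ, hw_def, hw_rat, hw_ind, hψw,
    hωB_def, hωB_rat, hωB_ne, hy⟩ := stub_cmSurfaceModel E ι hE hι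
  -- G2b: the descent pair
  obtain ⟨bp, bm, η, hbp, hbm, hbr, hbH, hη, hpη, hmη⟩ := stub_cmDescentPair E ι hE hι α β hα hβ hind hspan hωne
  -- G4′: hyperplane classes
  obtain ⟨g, hg_rat, hg_ne, hg_dim, hg_segre, hg_ver, hg_span, hg_sym⟩ := h₅
  -- dimensions
  have hB : (E.prod E).dim = 2 := by rw [AbelianVariety.dim_prod, hE]
  have hB' : (E.prod E).dim = 1 + 1 := hB
  have hA' : A.dim = (2 * n - 1) + 1 := by omega
  have hAB : 1 ≤ (A.prod (E.prod E)).dim := by rw [AbelianVariety.dim_prod, hB]; omega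
  have hEsp : IsSmoothProjective (0 + 1) E.X := by
    have h := AbelianVariety.isSmoothProjective_holds (A := E)
    rw [AbelianVariety.isSmoothProjective, hE] at h
    exact h
  -- the embedding of `A` and its `K`-symmetrised class `h_A`
  obtain ⟨eA⟩ : Nonempty (ProjectiveEmbedding A.X) :=
    ⟨(AbelianVariety.isSmoothProjective_holds (A := A)).isProjectiveOver.projectiveEmbedding⟩
  have heAn : 1 ≤ eA.n := hg_dim A eA (by omega)
  have haA : IsRationalClass (g eA.n) := hg_rat eA.n
  have haA0 : g eA.n ≠ 0 := hg_ne eA.n heAn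
  -- G3: the rational model of `(A, φ, h_A)` with its signature
  obtain ⟨u, M, G, ωA, d₀, hu_rat, hu_ind, hu_span, hMcol, hωA_rat, hωA_ne, hG, hd₀, hM2, hGt, hWA,
    hPN⟩ := h₄ n A φ hn hA hφ hwit eA (g eA.n) haA haA0
  -- the embedding of `E` and the coefficient `r₀` of its hyperplane class
  obtain ⟨eE⟩ : Nonempty (ProjectiveEmbedding E.X) :=
    ⟨(AbelianVariety.isSmoothProjective_holds (A := E)).isProjectiveOver.projectiveEmbedding⟩
  have h1 : Module.finrank ℂ (complexBetti E.X (2 + 2 * 0)) = 1 :=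
    Summit.HodgeConjecture.HodgeConjecture.Theorems.finrank_complexBetti_two_add_two_mul_eq_one hEsp
  obtain ⟨r₀, hr₀⟩ : ∃ r₀ : ℚ, complexBetti.map eE.ι 2 (g eE.n) =
      ((r₀ : ℚ) : ℂ) • cupProduct (rfl : 1 + 1 = 2) α β :=
    Summit.HodgeConjecture.HodgeConjecture.Theorems.exists_eq_ratCast_smul_of_finrank_eq_one
      (X := E.X) (k := 2) h1 (hα.cup _ hβ) hωne ((hg_rat eE.n).map _)
  -- XII: weights and isotropic block vectors
  have hcard : Fintype.card (Fin (4 * n)) = 4 * n := Fintype.card_fin _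
  obtain ⟨m₁, m₂, hm₁, hm₂, b, hb, hbM, hbG⟩ :=
    Summit.HodgeConjecture.HodgeConjecture.Theorems.exists_isotropic_blockVectors' (d := (7 : ℚ))
      (by norm_num) M hM2 G hGt hWA n hcard hPN ME hME2
      (!![(0 : ℚ), 1; -1, 0]) J_dotProduct_alternating ![1, 0] vecOneZero_ne_zero
      (((2 * (n + 1) - 1).choose (2 * n - 1) : ℚ) * (14 * 14 * (2 * r₀ * r₀)))
      (((2 * (n + 1) - 1).choose (2 * n - 1 + 1) : ℚ) * d₀ * (14 * r₀))
  -- the weighted class `y` on `B` and its model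
  obtain ⟨y, hy_def, hy_rat, hψy, hyG, hyy⟩ := hy r₀ m₁ m₂
  -- the weighted embedding of `B = E × E`
  obtain ⟨e₁, he₁⟩ := hg_ver E eE m₁ hm₁
  obtain ⟨e₂, he₂⟩ := hg_ver E eE m₂ hm₂
  obtain ⟨eB, heB⟩ := hg_segre E E e₁ e₂
  have heBy : complexBetti.map eB.ι 2 (g eB.n) = y := by
    rw [heB, he₁, he₂, hr₀, hy_def, map_smul, map_smul, map_smul, map_smul, smul_smul, smul_smul]
    push_cast
    congr 1 <;> ring_nf
  -- the Segre embedding of `A × B`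
  obtain ⟨e, he⟩ := hg_segre A (E.prod E) eA eB
  -- the model of `(B, ψ, 14 • y)`
  have hGB : ∀ k l, polarizationPairingOne (E.prod E).X ((14 : ℂ) • y) 1 (w k) (w l) =
      ((((14 : ℚ) • Matrix.fromBlocks (((m₂ : ℚ) * r₀) • !![(0 : ℚ), 1; -1, 0]) 0 0
        (((m₁ : ℚ) * r₀) • !![(0 : ℚ), 1; -1, 0])) k l : ℚ) : ℂ) • ωB := by
    intro k l
    rw [polarizationPairingOne_smul, hyG k l, pow_one, smul_smul, Matrix.smul_apply, smul_eq_mul]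
    push_cast
    rfl
  have hdB : lefschetzPow ((14 : ℂ) • y) 1 2 ((14 : ℂ) • y) =
      (((14 : ℚ) * ((14 : ℚ) * (2 * m₁ * m₂ * r₀ * r₀)) : ℚ) : ℂ) • ωB := by
    rw [lefschetzPow_smul, pow_one, map_smul, hyy, smul_smul, smul_smul]
    push_cast
    ring_nf
  -- the two block Gram matrices agree
  have hmat : Matrix.fromBlocks
        ((((2 * (n + 1) - 1).choose (2 * n - 1) : ℚ) * ((14 : ℚ) * ((14 : ℚ) * (2 * m₁ * m₂ * r₀ * r₀)))) • G)
        0 0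
        ((((2 * (n + 1) - 1).choose (2 * n - 1 + 1) : ℚ) * d₀) •
          ((14 : ℚ) • Matrix.fromBlocks (((m₂ : ℚ) * r₀) • !![(0 : ℚ), 1; -1, 0]) 0 0
            (((m₁ : ℚ) * r₀) • !![(0 : ℚ), 1; -1, 0]))) =
      Matrix.fromBlocks
        ((((2 * (n + 1) - 1).choose (2 * n - 1) : ℚ) * (14 * 14 * (2 * r₀ * r₀)) * m₁ * m₂) • G) 0 0
        (Matrix.fromBlocks
          ((((2 * (n + 1) - 1).choose (2 * n - 1 + 1) : ℚ) * d₀ * (14 * r₀) * m₂) • !![(0 : ℚ), 1; -1, 0])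
          0 0
          ((((2 * (n + 1) - 1).choose (2 * n - 1 + 1) : ℚ) * d₀ * (14 * r₀) * m₁) • !![(0 : ℚ), 1; -1, 0])) := by
    rw [Matrix.fromBlocks_smul, Matrix.fromBlocks_smul, smul_zero, smul_zero, smul_smul, smul_smul,
      smul_smul, smul_smul]
    congr 1
    · congr 1; ring
    · congr 1 <;> (congr 1; ring)
  have hbG' : ∀ k l, ∑ s, ∑ t, b k s *
      (Matrix.fromBlocks
        ((((2 * (n + 1) - 1).choose (2 * n - 1) : ℚ) * ((14 : ℚ) * ((14 : ℚ) * (2 * m₁ * m₂ * r₀ * r₀)))) • G)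
        0 0
        ((((2 * (n + 1) - 1).choose (2 * n - 1 + 1) : ℚ) * d₀) •
          ((14 : ℚ) • Matrix.fromBlocks (((m₂ : ℚ) * r₀) • !![(0 : ℚ), 1; -1, 0]) 0 0
            (((m₁ : ℚ) * r₀) • !![(0 : ℚ), 1; -1, 0])))) s t * b l t = 0 := by
    intro k l
    rw [hmat]
    exact hbG k l
  -- file VI: hyperbolicity of the product for `fst^* h_A + snd^* (14 • y)`
  have hhyp := Summit.HodgeConjecture.HodgeConjecture.Theorems.isHyperbolicWeilType_prod_of_rationalModels
    (A := A) (B := E.prod E) φ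
    (AbelianVariety.prodLift (AbelianVariety.fst E E ≫ ι) (AbelianVariety.snd E E ≫ (-ι)))
    (jA := 2 * n - 1) (jB := 1) (N := n + 1) hA' hB' (by omega)
    u hu_rat hu_ind M hMcol w hw_rat hw_ind (Matrix.fromBlocks ME 0 0 (-ME)) hψw
    ((7 : ℂ) • complexBetti.map eA.ι 2 (g eA.n) + complexBetti.map φ.hom.hom.hom 2 (complexBetti.map eA.ι 2 (g eA.n)))
    ωA G hG d₀ hd₀ ((14 : ℂ) • y) ωB _ hGB _ hdB b hb hbM hbG'
  -- the `K`-symmetrised hyperplane class of the Segre embedding is `fst^* h_A + snd^* (14 • y)`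
  have hclass : (7 : ℂ) • complexBetti.map e.ι 2 (g e.n) +
      complexBetti.map (AbelianVariety.prodLift (AbelianVariety.fst A (E.prod E) ≫ φ)
        (AbelianVariety.snd A (E.prod E) ≫
          AbelianVariety.prodLift (AbelianVariety.fst E E ≫ ι) (AbelianVariety.snd E E ≫ (-ι)))).hom.hom.hom 2
        (complexBetti.map e.ι 2 (g e.n)) =
      complexBetti.map (AbelianVariety.fst A (E.prod E)).hom.hom.hom 2
          ((7 : ℂ) • complexBetti.map eA.ι 2 (g eA.n) +
            complexBetti.map φ.hom.hom.hom 2 (complexBetti.map eA.ι 2 (g eA.n))) +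
        complexBetti.map (AbelianVariety.snd A (E.prod E)).hom.hom.hom 2 ((14 : ℂ) • y) := by
    rw [he, heBy, map_add,
      Summit.HodgeConjecture.HodgeConjecture.Theorems.map_prodLift_map_fst,
      Summit.HodgeConjecture.HodgeConjecture.Theorems.map_prodLift_map_snd, hψy, map_add, map_smul,
      map_smul, smul_add]
    have h14 : (14 : ℂ) • y = (7 : ℂ) • y + (7 : ℂ) • y := by rw [← add_smul]; norm_num
    rw [h14, map_add, map_smul]
    abel
  -- assemble
  refine ⟨E.prod E, _, hB, hψψ, ⟨bp, bm, η, hbp, hbm, hbr, hbH, hη, hpη, hmη⟩, e, g e.n, hg_rat e.n,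
    hg_ne e.n (hg_dim (A.prod (E.prod E)) e hAB), ?_⟩
  rw [hclass]
  exact hhyp


end Summit.HodgeConjecture.HodgeConjecture.Theorems.WeilSixfoldsSqrtMinus7.HyperbolicEightfoldDescent

end
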